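import Summits.ResolutionOfSingularities.ResolutionOfSingularities.Theorems.FrobeniusClosingSteerArithLeafWords
import Summits.ResolutionOfSingularities.ResolutionOfSingularities.Theorems.FrobeniusClosingSteerShadowVacuous
import Summits.ResolutionOfSingularities.ResolutionOfSingularities.Theorems.FrobeniusClosingSteerNoHeightOneCarrierTwo
import Summits.ResolutionOfSingularities.ResolutionOfSingularities.Theorems.FrobeniusClosingSteerPointStepNoSurfaceCleaning
import HarnessLib

/-!
# Crux `Steer` (stmt-ResolutionOfSingularities-16345), chain W4.1 — **(HYG) `ArithLeaf.ArithRunHygieneTwoN` HOLDS** (by-name discharge of the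
# T-line binder hHyg; def-free, Theses-free, 0 sorries)

OURS (campaign `res-hironaka`, rung L ★L-G4, slot W4.1; seat res-L0-w41-strat-2 g4 = CHAIN v6.24 A1 (iii) «hHyg BY-NAME DISCHARGE
(`arithRunHygieneTwoN_holds`, strat-2) — drops the T-line of record `eternalSteeredRunTwo_of_slate18_hk4_aro` from 14 to 13 binders»).
Candidates, not facts; nothing here is a statement of H. Hironakaʼs manuscript [Hironaka2017] (status: under review). AI-written; AI review is
weaker than expert review.

THE WORD (`…ArithLeafWords`, p559461): along a σ_top-steered run from a `NormalAt` core datum (p = 2, n = 4, rank one) there is a bound `N₁` with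
(1) every member regular, (2) every member of Krull dimension `4`, (3) no singular prime of height `0` and (4) none of height `1` of the radicand
`(s j)²` at any point step `j ≥ N₁`. PROOF (`N₁ = 0`, every input LANDED): (1) `Words.steeredMembersRegular_holds`; (2) and the field generic fibre
`hirr` from `runHygieneTwo_holds`; (3) a height-`0` prime of the (domain) member is `⊥` (`Ideal.height_eq_zero_iff_eq_bot`) and the generic torsor
fibre is a field (`NoHeightOneCarrier.isRegularLocalRing_radicand_of_eq_bot`, from `hirr`); (4) at a point step the generator is MAXIMAL
(`MaxVacuity.isMaxGenAt_of_isPointStep`: (N4) `noSingularCarrier_along_run` + the carrier dichotomy + the M1 dictionary) and satisfies the local–global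
Frobenius congruence (N5) (`MaxVacuity.memberFrobeniusCongruence_two`), so res-D-pv-035ʼs (L2) `PointStepNoSurfaceCleaning.not_isSingPrime_of_height_one_of_isMaxGenAt`
(a singular height-one prime `(u)` would give a non-unit form `s = g₀ + u·s″`) excludes singular height-one primes. The point-step hypothesis is
used only in (4); (1)–(3) hold at every stage.
-/

-- `Summit.<S>.<S>.…` duplicates the summit name by design (single-problem summit).
set_option linter.dupNamespace false

open IsLocalRing
open Literature.AlgebraicGeometry.Resolution
open Summit.ResolutionOfSingularities.ResolutionOfSingularities.Theorems.SwitchingDichotomy.Words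
open Summit.ResolutionOfSingularities.ResolutionOfSingularities.Theorems.SteerRankThinness (Concl HasProperCoarsening)
open Summit.ResolutionOfSingularities.ResolutionOfSingularities.Theorems.SwitchingDichotomy.ArithReduction
open Summit.ResolutionOfSingularities.ResolutionOfSingularities.Theorems.SwitchingDichotomy

namespace Summit.ResolutionOfSingularities.ResolutionOfSingularities.Theorems.SwitchingDichotomy.ArithLeaf

/-- **(HYG) HOLDS** — `ArithRunHygieneTwoN` with the bound `N₁ = 0`. See the module docstring. OURS. [cite: Matsumura1987, Thm. 20.3] [folklore] -/
theorem arithRunHygieneTwoN_holds : ArithRunHygieneTwoN := by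
  intro p hp2 k K _ _ _ _ _ O A₀ h₀ t core hrk R P s hR0 hN hrun
  subst hp2
  classical
  haveI : Fact (Nat.Prime 2) := ⟨Nat.prime_two⟩
  haveI : CharP K 2 := charP_of_injective_algebraMap (algebraMap k K).injective 2
  obtain ⟨-, -, hdim, -, hirr, -⟩ := runHygieneTwo_holds 2 rfl k K O A₀ h₀ t core hrk R P s hR0 hrun
  have hreg : ∀ i, IsRegularLocalRing (R i) := fun i =>
    steeredMembersRegular_holds 2 Nat.prime_two 4 le_rfl k K O A₀ h₀ t core R P s i hR0
      ⟨hrun.1, fun j _ => by obtain ⟨_, hs, -⟩ := hrun.2 j; exact hs, fun j _ => hrun.2 j⟩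
  refine ⟨0, hreg, fun i => by exact_mod_cast hdim i, fun j _ _ hs' Q _ hQ0 => ?_, fun j _ hPj hs' Q _ hQ1 => ?_⟩
  · -- (3) height 0: `Q = ⊥`, and the generic torsor fibre is a field
    haveI := hreg j
    have hQ : Q = ⊥ := Ideal.height_eq_zero_iff_eq_bot.mp hQ0
    exact fun h => h (NoHeightOneCarrier.isRegularLocalRing_radicand_of_eq_bot (R j) (s j) hs' (hirr j) Q hQ)
  · -- (4) height 1 at a point step: maximal generator + (N5) ⇒ no singular height-one prime (pv-035ʼs (L2))
    haveI := hreg j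
    exact HevLeaf.PointStepNoSurfaceCleaning.not_isSingPrime_of_height_one_of_isMaxGenAt (R j) t (s j) hs' (hirr j)
      (fun π a b c hπ hπb heq =>
        MaxVacuity.memberFrobeniusCongruence_two k K O A₀ h₀ t core R P s hR0 hrun j hs' π a b c hπ hπb heq)
      (MaxVacuity.isMaxGenAt_of_isPointStep k K O A₀ h₀ t core hrk R P s hR0 hN hrun j hPj) Q hQ1

end Summit.ResolutionOfSingularities.ResolutionOfSingularities.Theorems.SwitchingDichotomy.ArithLeaf
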